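import Literature.Analysis.UnboundedOperators.CoreFormGroundStateSimple
import HarnessLib

/-!
# The ground state of a semibounded form on `L²` has a sign — core-language version for MINIMIZING SEQUENCES

Companion of `Literature.Analysis.UnboundedOperators.CoreFormGroundStateSimple` (`sInf_coreLevelSet_zero_lt_one`:
under Beurling–Deny contraction on the core + positivity of nonnegative weak ground states, the lowest min–max level
of a semibounded form on `L²(X)` is simple).  That file proves, INSIDE one proof, the classical intermediate step
«every ground state has a sign» (Courant–Hilbert VI §6: «the first eigenfunction does not change sign»; Lieb–Loss
Thm 11.8: a minimizer `ψ` has `|ψ|` a minimizer, hence `ψ⁺` or `ψ⁻` vanishes; Reed–Simon IV Thm XIII.48) for the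
null vectors of `q̃ = ‖·‖_Q² − (μ₀+1)‖J·‖²` on the completed form domain `Q`.  Consumers who hold a CONCRETE candidate
ground state — typically a classical eigenfunction `ψ` known only through smoothness, the pointwise eigen-equation and
decay, so that `χ_R ψ → ψ` is a minimizing sequence of core elements — need that step BY NAME and in CORE LANGUAGE,
without the completion in the statement.  This file provides it:

* `cauchySeq_of_qform_tendsto_zero` — for `q̃ = ‖·‖² − c‖ι·‖² ≥ 0` on the core (`c > 0`), a sequence with
  `q̃(f_n) → 0` and `(ι f_n)` Cauchy in `H` is Cauchy in the core norm (parallelogram law for `q̃`);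
* `exists_null_vector_abs` — CONTRACTION lifted to the completion: a null vector `x` of `q̃` on `Q = V̂` has a null
  vector `x'` with `J x' = |J x|` (public form of the private step of the companion file);
* `sign_of_null_vector` — POSITIVITY: every null vector `x` of `q̃` on `Q` has `J x ≥ 0` or `J x ≤ 0` in `L²`;
* ★ `sign_of_core_minimizing_seq` — **core language**: data `(V, ι, S)` with Kato's identity
  `⟪f, g⟫_V = ⟪S f, ι g⟫ + ⟪ι f, ι g⟫`, (contraction) and (positivity) exactly as in `sInf_coreLevelSet_zero_lt_one`,
  a form lower bound `m‖ι f‖² ≤ ‖f‖² − ‖ι f‖²` on the core (`m > −1`; e.g. `m = μ₀`), and core elements `f_n` with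
  `ι f_n → w` in `L²` and `‖f_n‖² − (m+1)‖ι f_n‖² → 0` (a minimizing sequence: `𝔥[f_n] − m‖ι f_n‖² → 0`).  THEN
  `0 ≤ w` or `w ≤ 0` in `L²(X)`.  (No compactness and no dimension hypothesis are needed for this step.)

PROOF.  `q̃ ≥ 0` on the core by the lower bound, on `Q` by density; `(f_n)` is Cauchy in `V` by the parallelogram
law, its limit `x ∈ Q` has `J x = w` and `q̃(x) = 0`; first variation makes null vectors weak eigenvectors and a linear
subspace; CONTRACTION gives `x'` null with `J x' = |J x|`, so `(Jx)^± = J((x' ± x)/2)` are images of null vectors,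
nonnegative, `L²`-orthogonal; POSITIVITY forbids both being nonzero.  No definitions, no named facts, no instances.

## References
* [ReedSimonIV1978] M. Reed, B. Simon, *Methods of Modern Mathematical Physics IV*, §XIII.12 Thm XIII.48
  (the ground state of `−Δ + V` is strictly positive and non-degenerate), Thm XIII.2.
* [LiebLoss2001] E. H. Lieb, M. Loss, *Analysis*, 2nd ed., AMS GSM 14, Thm 7.8 (`‖∇|f|‖₂ ≤ ‖∇f‖₂`),
  Thm 11.8 (uniqueness of minimizers / positivity of the ground state, PDF pp. 205–206).
* [GlimmJaffeQP1987] J. Glimm, A. Jaffe, *Quantum Physics*, 2nd ed., §3.3 Thm 3.3.2–3.3.3, Cor 3.3.4.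
* [Kato1966] T. Kato, *Perturbation Theory for Linear Operators*, VI §1.1 (1.2), Thm 1.27.
-/

noncomputable section

open UniformSpace Filter _root_.Topology _root_.MeasureTheory
open scoped InnerProductSpace

namespace Literature.Analysis.UnboundedOperators

open Literature.Analysis.OperatorTheory

/-! ### 1. Quadratic-form algebra for `q̃ = ‖·‖² − c‖J·‖²` -/

section QuadForm

variable {Q : Type*} [NormedAddCommGroup Q] [InnerProductSpace ℝ Q]
variable {H : Type*} [NormedAddCommGroup H] [InnerProductSpace ℝ H]

/-- Polarisation of `q̃(x) = ‖x‖² − c‖Jx‖²` on `a•x + b•y`. [cite: Kato1966, VI §1.1 (1.2)] -/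
theorem qform_expand (J : Q →L[ℝ] H) (c a b : ℝ) (x y : Q) :
    ‖a • x + b • y‖ ^ 2 - c * ‖J (a • x + b • y)‖ ^ 2 =
      a ^ 2 * (‖x‖ ^ 2 - c * ‖J x‖ ^ 2) + b ^ 2 * (‖y‖ ^ 2 - c * ‖J y‖ ^ 2) +
        2 * a * b * (⟪x, y⟫_ℝ - c * ⟪J x, J y⟫_ℝ) := by
  rw [map_add, map_smul, map_smul, norm_add_sq_real, norm_add_sq_real, norm_smul, norm_smul, norm_smul,
    norm_smul, real_inner_smul_left, real_inner_smul_right, real_inner_smul_left, real_inner_smul_right]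
  simp only [Real.norm_eq_abs, mul_pow, sq_abs]
  ring

/-- First-variation step: if `2tB + t²A ≥ 0` for all real `t` with `A ≥ 0`, then `B = 0`.
[cite: LiebLoss2001, Thm. 11.8 (proof)] -/
theorem linear_coeff_eq_zero_of_forall_nonneg {A B : ℝ} (hA : 0 ≤ A)
    (h : ∀ t : ℝ, 0 ≤ 2 * t * B + t ^ 2 * A) : B = 0 := by
  have hD : 0 < (A + 1) ^ 2 := by positivity
  have ht := h (-B / (A + 1))
  have hcalc : 2 * (-B / (A + 1)) * B + (-B / (A + 1)) ^ 2 * A = -(B ^ 2 * (A + 2)) / (A + 1) ^ 2 := by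
    field_simp
    ring
  rw [hcalc] at ht
  have ht2 : 0 ≤ -(B ^ 2 * (A + 2)) := by
    have := mul_nonneg ht hD.le
    rwa [div_mul_cancel₀ _ hD.ne'] at this
  have hB2 : B ^ 2 = 0 := by nlinarith [sq_nonneg B]
  exact pow_eq_zero_iff two_ne_zero |>.1 hB2

/-- Parallelogram consequence for `q̃ = ‖·‖² − c‖J·‖² ≥ 0`: `‖a − b‖² ≤ 2q̃(a) + 2q̃(b) + c‖Ja − Jb‖²`.
[cite: Kato1966, VI §1.1 (1.2)] -/
theorem norm_sub_sq_le_of_qform_nonneg (J : Q →L[ℝ] H) {c : ℝ}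
    (hq : ∀ z : Q, 0 ≤ ‖z‖ ^ 2 - c * ‖J z‖ ^ 2) (a b : Q) :
    ‖a - b‖ ^ 2 ≤ 2 * (‖a‖ ^ 2 - c * ‖J a‖ ^ 2) + 2 * (‖b‖ ^ 2 - c * ‖J b‖ ^ 2) + c * ‖J a - J b‖ ^ 2 := by
  have h1 := qform_expand J c 1 1 a b
  have h2 := qform_expand J c 1 (-1) a b
  have hs := hq ((1 : ℝ) • a + (1 : ℝ) • b)
  rw [h1] at hs
  have hd : (1 : ℝ) • a + (-1 : ℝ) • b = a - b := by rw [one_smul, neg_one_smul, sub_eq_add_neg]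
  rw [hd, map_sub] at h2
  nlinarith [h2, hs]

/-- **A `q̃`-null sequence with Cauchy images is Cauchy.**  If `q̃ = ‖·‖² − c‖J·‖² ≥ 0` on `Q` (`c > 0`),
`q̃(f_n) → 0` and `(J f_n)` is Cauchy in `H`, then `(f_n)` is Cauchy in `Q`. [cite: LiebLoss2001, Thm. 11.8 (proof)] -/
theorem cauchySeq_of_qform_tendsto_zero (J : Q →L[ℝ] H) {c : ℝ} (hc0 : 0 < c)
    (hq : ∀ z : Q, 0 ≤ ‖z‖ ^ 2 - c * ‖J z‖ ^ 2) (f : ℕ → Q)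
    (hqf : Tendsto (fun n => ‖f n‖ ^ 2 - c * ‖J (f n)‖ ^ 2) atTop (𝓝 0))
    (hJf : CauchySeq fun n => J (f n)) : CauchySeq f := by
  have hpar : ∀ n m, ‖f n - f m‖ ^ 2 ≤
      2 * (‖f n‖ ^ 2 - c * ‖J (f n)‖ ^ 2) + 2 * (‖f m‖ ^ 2 - c * ‖J (f m)‖ ^ 2) +
        c * ‖J (f n) - J (f m)‖ ^ 2 := fun n m => norm_sub_sq_le_of_qform_nonneg J hq (f n) (f m)
  rw [Metric.cauchySeq_iff]
  intro ε hε
  have hε2 : 0 < ε ^ 2 / 5 := by positivity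
  rw [Metric.cauchySeq_iff] at hJf
  obtain ⟨N₁, hN₁⟩ := hJf (Real.sqrt (ε ^ 2 / 5 / c)) (Real.sqrt_pos.2 (div_pos hε2 hc0))
  obtain ⟨N₂, hN₂⟩ := (Metric.tendsto_atTop.1 hqf) (ε ^ 2 / 5) hε2
  refine ⟨max N₁ N₂, fun m hm n hn => ?_⟩
  have hm1 : m ≥ N₁ := le_trans (le_max_left _ _) hm
  have hn1 : n ≥ N₁ := le_trans (le_max_left _ _) hn
  have hm2 : m ≥ N₂ := le_trans (le_max_right _ _) hm
  have hn2 : n ≥ N₂ := le_trans (le_max_right _ _) hn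
  have h1 : ‖J (f m) - J (f n)‖ ^ 2 < ε ^ 2 / 5 / c := by
    have h := hN₁ m hm1 n hn1
    rw [dist_eq_norm] at h
    have h' := pow_lt_pow_left₀ h (norm_nonneg _) two_ne_zero
    rwa [Real.sq_sqrt (div_pos hε2 hc0).le] at h'
  have h1' : c * ‖J (f m) - J (f n)‖ ^ 2 < ε ^ 2 / 5 := by
    have := mul_lt_mul_of_pos_left h1 hc0
    rwa [mul_div_cancel₀ _ hc0.ne'] at this
  have h2 : ‖f m‖ ^ 2 - c * ‖J (f m)‖ ^ 2 < ε ^ 2 / 5 := by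
    have h := hN₂ m hm2
    rw [dist_eq_norm, sub_zero, Real.norm_eq_abs] at h
    exact lt_of_abs_lt h
  have h3 : ‖f n‖ ^ 2 - c * ‖J (f n)‖ ^ 2 < ε ^ 2 / 5 := by
    have h := hN₂ n hn2
    rw [dist_eq_norm, sub_zero, Real.norm_eq_abs] at h
    exact lt_of_abs_lt h
  have h4 : ‖f m - f n‖ ^ 2 < ε ^ 2 := by
    have := hpar m n
    linarith
  rw [dist_eq_norm]
  exact lt_of_pow_lt_pow_left₀ 2 hε.le h4

end QuadForm

/-! ### 2. Contraction on the completed form domain -/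

section Contraction

variable {X : Type*} [MeasurableSpace X] {μX : Measure X}
variable {V : Type*} [NormedAddCommGroup V] [InnerProductSpace ℝ V]

/-- **CONTRACTION, lifted to the completed form domain.**  `J : V̂ →L L²` a continuous linear map agreeing with
`ι` on the core, `q̃ = ‖·‖² − c‖J·‖² ≥ 0` on `V̂` (`c > 0`), and every core element `f` has core elements `f'` with
`ι f'` close to `|ι f|` and `‖f'‖ ≤ ‖f‖ + ε`.  Then every null vector `x` of `q̃` has a null vector `x'` with
`J x' = |J x|`. [cite: LiebLoss2001, Thm. 7.8, Thm. 11.8 (proof: `|ψ|` is again a minimizer)] -/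
theorem exists_null_vector_abs (ι : V →L[ℝ] Lp ℝ 2 μX) (J : Completion V →L[ℝ] Lp ℝ 2 μX)
    (hJcoe : ∀ f : V, J (f : Completion V) = ι f) {c : ℝ} (hc0 : 0 < c)
    (hq : ∀ z : Completion V, 0 ≤ ‖z‖ ^ 2 - c * ‖J z‖ ^ 2)
    (habs : ∀ (f : V) (ε : ℝ), 0 < ε → ∃ f' : V, ‖ι f' - |ι f|‖ ≤ ε ∧ ‖f'‖ ≤ ‖f‖ + ε)
    (x : Completion V) (hx : ‖x‖ ^ 2 - c * ‖J x‖ ^ 2 = 0) :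
    ∃ x' : Completion V, ‖x'‖ ^ 2 - c * ‖J x'‖ ^ 2 = 0 ∧ J x' = |J x| := by
  -- `q̃` on the core
  have hqV : ∀ f : V, 0 ≤ ‖f‖ ^ 2 - c * ‖ι f‖ ^ 2 := fun f => by
    have h := hq (f : Completion V)
    rwa [Completion.norm_coe, hJcoe] at h
  -- core elements `f n → x` in `Q`
  have hxcl : x ∈ closure (Set.range ((↑) : V → Completion V)) := by
    rw [Completion.denseRange_coe.closure_range]; exact Set.mem_univ x
  obtain ⟨u, hu_mem, hu_lim⟩ := mem_closure_iff_seq_limit.1 hxcl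
  choose f hf using hu_mem
  have hf_lim : Tendsto (fun n => (f n : Completion V)) atTop (𝓝 x) := by
    have : (fun n => (f n : Completion V)) = u := funext hf
    rw [this]; exact hu_lim
  -- the contracted approximants `f' n`
  have hεpos : ∀ n : ℕ, (0 : ℝ) < 1 / ((n : ℝ) + 1) := fun n => by positivity
  choose f' hf'1 hf'2 using fun n : ℕ => habs (f n) (1 / ((n : ℝ) + 1)) (hεpos n)
  have hε_lim : Tendsto (fun n : ℕ => 1 / ((n : ℝ) + 1)) atTop (𝓝 0) :=
    tendsto_one_div_add_atTop_nhds_zero_nat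
  -- (a) `ι f'_n → |J x|`
  have hJf_lim : Tendsto (fun n => ι (f n)) atTop (𝓝 (J x)) := by
    have h := (J.continuous.tendsto x).comp hf_lim
    refine h.congr fun n => ?_
    simp only [Function.comp_apply, hJcoe]
  have habsJf_lim : Tendsto (fun n => |ι (f n)|) atTop (𝓝 |J x|) := by
    rw [tendsto_iff_norm_sub_tendsto_zero] at hJf_lim ⊢
    exact squeeze_zero (fun n => norm_nonneg _) (fun n => norm_abs_sub_abs _ _) hJf_lim
  have hιf'_lim : Tendsto (fun n => ι (f' n)) atTop (𝓝 |J x|) := by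
    rw [tendsto_iff_norm_sub_tendsto_zero] at habsJf_lim ⊢
    have hbound : ∀ n, ‖ι (f' n) - |J x|‖ ≤ 1 / ((n : ℝ) + 1) + ‖|ι (f n)| - |J x|‖ := fun n =>
      calc ‖ι (f' n) - |J x|‖ = ‖(ι (f' n) - |ι (f n)|) + (|ι (f n)| - |J x|)‖ := by
            congr 1; abel
        _ ≤ ‖ι (f' n) - |ι (f n)|‖ + ‖|ι (f n)| - |J x|‖ := norm_add_le _ _
        _ ≤ 1 / ((n : ℝ) + 1) + ‖|ι (f n)| - |J x|‖ := by gcongr; exact hf'1 n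
    refine squeeze_zero (fun n => norm_nonneg _) hbound ?_
    simpa using hε_lim.add habsJf_lim
  -- (b) `q̃(f'_n) → 0`
  have hnormf_lim : Tendsto (fun n => ‖f n‖) atTop (𝓝 ‖x‖) := by
    have h := (continuous_norm.tendsto x).comp hf_lim
    refine h.congr fun n => ?_
    simp only [Function.comp_apply, Completion.norm_coe]
  have hq'_le : ∀ n, ‖f' n‖ ^ 2 - c * ‖ι (f' n)‖ ^ 2 ≤
      (‖f n‖ + 1 / ((n : ℝ) + 1)) ^ 2 - c * ‖ι (f' n)‖ ^ 2 := fun n => by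
    have h1 : ‖f' n‖ ^ 2 ≤ (‖f n‖ + 1 / ((n : ℝ) + 1)) ^ 2 :=
      pow_le_pow_left₀ (norm_nonneg _) (hf'2 n) 2
    linarith
  have hupper_lim : Tendsto (fun n : ℕ => (‖f n‖ + 1 / ((n : ℝ) + 1)) ^ 2 - c * ‖ι (f' n)‖ ^ 2)
      atTop (𝓝 0) := by
    have h1 : Tendsto (fun n : ℕ => (‖f n‖ + 1 / ((n : ℝ) + 1)) ^ 2) atTop (𝓝 (‖x‖ ^ 2)) := by
      have := (hnormf_lim.add hε_lim).pow 2
      simpa using this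
    have h2 : Tendsto (fun n => c * ‖ι (f' n)‖ ^ 2) atTop (𝓝 (c * ‖J x‖ ^ 2)) := by
      have := ((continuous_norm.tendsto _).comp hιf'_lim).pow 2
      rw [Function.comp_def, norm_abs_eq_norm] at this
      exact this.const_mul c
    have h3 := h1.sub h2
    rwa [hx] at h3
  have hq'_lim : Tendsto (fun n => ‖f' n‖ ^ 2 - c * ‖ι (f' n)‖ ^ 2) atTop (𝓝 0) :=
    tendsto_of_tendsto_of_tendsto_of_le_of_le tendsto_const_nhds hupper_lim (fun n => hqV (f' n)) hq'_le
  -- (c) `(f'_n)` is Cauchy in `V`, hence convergent in `Q`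
  have hcauchyV : CauchySeq f' := cauchySeq_of_qform_tendsto_zero ι hc0 hqV f' hq'_lim hιf'_lim.cauchySeq
  have hcauchy : CauchySeq fun n => (f' n : Completion V) :=
    (Completion.uniformContinuous_coe V).comp_cauchySeq hcauchyV
  -- (d) the limit `x'`
  obtain ⟨x', hx'⟩ := cauchySeq_tendsto_of_complete hcauchy
  have hcoe_seq : (fun n => J (f' n : Completion V)) = fun n => ι (f' n) := funext fun n => hJcoe (f' n)
  have hJx' : J x' = |J x| := by
    have h1 : Tendsto (fun n => J (f' n : Completion V)) atTop (𝓝 (J x')) :=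
      (J.continuous.tendsto x').comp hx'
    rw [hcoe_seq] at h1
    exact tendsto_nhds_unique h1 hιf'_lim
  have hqx' : ‖x'‖ ^ 2 - c * ‖J x'‖ ^ 2 = 0 := by
    have hcont : Continuous fun z : Completion V => ‖z‖ ^ 2 - c * ‖J z‖ ^ 2 := by fun_prop
    have h1 : Tendsto (fun n => ‖(f' n : Completion V)‖ ^ 2 - c * ‖J (f' n : Completion V)‖ ^ 2) atTop
        (𝓝 (‖x'‖ ^ 2 - c * ‖J x'‖ ^ 2)) := (hcont.tendsto x').comp hx'
    have hseq : (fun n => ‖(f' n : Completion V)‖ ^ 2 - c * ‖J (f' n : Completion V)‖ ^ 2) =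
        fun n => ‖f' n‖ ^ 2 - c * ‖ι (f' n)‖ ^ 2 :=
      funext fun n => by rw [Completion.norm_coe, hJcoe]
    rw [hseq] at h1
    exact tendsto_nhds_unique h1 hq'_lim
  exact ⟨x', hqx', hJx'⟩

/-! ### 3. Every null vector has a sign -/

/-- **POSITIVITY ⇒ every ground state has a sign.**  With the core datum `(V, ι, S)` (Kato's identity
`⟪f, g⟫_V = ⟪S f, ι g⟫ + ⟪ι f, ι g⟫`), `J : V̂ →L L²` agreeing with `ι` on the core, `q̃ = ‖·‖² − c‖J·‖² ≥ 0` on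
`V̂` (`c > 0`), CONTRACTION on the core and POSITIVITY of nonnegative nonzero weak eigenvectors in the closure of
`ι(V)`: every null vector `x` of `q̃` has `J x ≥ 0` or `J x ≤ 0` in `L²(X)` (the first eigenfunction does not change
sign). [cite: ReedSimonIV1978, Thm. XIII.48] [cite: LiebLoss2001, Thm. 11.8] -/
theorem sign_of_null_vector (ι : V →L[ℝ] Lp ℝ 2 μX) (S : V → Lp ℝ 2 μX)
    (hS : ∀ f g : V, ⟪f, g⟫_ℝ = ⟪S f, ι g⟫_ℝ + ⟪ι f, ι g⟫_ℝ)
    (J : Completion V →L[ℝ] Lp ℝ 2 μX) (hJcoe : ∀ f : V, J (f : Completion V) = ι f)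
    (habs : ∀ (f : V) (ε : ℝ), 0 < ε → ∃ f' : V, ‖ι f' - |ι f|‖ ≤ ε ∧ ‖f'‖ ≤ ‖f‖ + ε)
    (hpos : ∀ (c : ℝ) (w : Lp ℝ 2 μX), w ∈ closure (Set.range ι) →
      (∀ g : V, ⟪w, S g⟫_ℝ = c * ⟪w, ι g⟫_ℝ) → 0 ≤ w → w ≠ 0 →
      ∀ v : Lp ℝ 2 μX, 0 ≤ v → v ≠ 0 → 0 < ⟪w, v⟫_ℝ)
    {c : ℝ} (hc0 : 0 < c) (hq : ∀ z : Completion V, 0 ≤ ‖z‖ ^ 2 - c * ‖J z‖ ^ 2)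
    (x : Completion V) (hx : ‖x‖ ^ 2 - c * ‖J x‖ ^ 2 = 0) :
    0 ≤ J x ∨ J x ≤ 0 := by
  -- the symmetric form of Kato's identity, transported to the completion
  have hS' : ∀ f g : V, ⟪f, g⟫_ℝ = ⟪ι f, S g⟫_ℝ + ⟪ι f, ι g⟫_ℝ := fun f g => by
    rw [← real_inner_comm f g, hS g f, real_inner_comm (ι f) (S g), real_inner_comm (ι f) (ι g)]
  have hJcl : ∀ z : Completion V, J z ∈ closure (Set.range ι) := fun z =>
    Completion.induction_on z (isClosed_closure.preimage J.continuous)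
      fun f => subset_closure ⟨f, (hJcoe f).symm⟩
  have hcore : ∀ (g : V) (z : Completion V),
      ⟪z, (g : Completion V)⟫_ℝ = ⟪J z, S g⟫_ℝ + ⟪J z, ι g⟫_ℝ := fun g z =>
    Completion.induction_on z
      (isClosed_eq (continuous_id.inner continuous_const)
        ((J.continuous.inner continuous_const).add (J.continuous.inner continuous_const)))
      fun f => by rw [Completion.inner_coe, hJcoe, hS' f g]
  -- first variation: null vectors are weak eigenvectors in `Q`
  have hvar : ∀ y z : Completion V, ‖y‖ ^ 2 - c * ‖J y‖ ^ 2 = 0 →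
      ⟪y, z⟫_ℝ = c * ⟪J y, J z⟫_ℝ := by
    intro y z hy
    have key : ∀ t : ℝ, 0 ≤ 2 * t * (⟪y, z⟫_ℝ - c * ⟪J y, J z⟫_ℝ) + t ^ 2 * (‖z‖ ^ 2 - c * ‖J z‖ ^ 2) := by
      intro t
      have h := hq ((1 : ℝ) • y + t • z)
      rw [qform_expand J c 1 t y z, hy] at h
      linarith
    have := linear_coeff_eq_zero_of_forall_nonneg (hq z) key
    linarith
  -- null vectors form a linear subspace
  have hlin : ∀ (a b : ℝ) (y z : Completion V), ‖y‖ ^ 2 - c * ‖J y‖ ^ 2 = 0 →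
      ‖z‖ ^ 2 - c * ‖J z‖ ^ 2 = 0 → ‖a • y + b • z‖ ^ 2 - c * ‖J (a • y + b • z)‖ ^ 2 = 0 := by
    intro a b y z hy hz
    rw [qform_expand J c a b y z, hy, hz, hvar y z hy]
    ring
  -- the weak eigen-equation in `L²` for null vectors, eigenvalue `c − 1`
  have hGweak : ∀ y : Completion V, ‖y‖ ^ 2 - c * ‖J y‖ ^ 2 = 0 →
      ∀ g : V, ⟪J y, S g⟫_ℝ = (c - 1) * ⟪J y, ι g⟫_ℝ := by
    intro y hy g
    have h1 := hvar y (g : Completion V) hy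
    rw [hcore g y, hJcoe] at h1
    linarith
  -- CONTRACTION: a null `x'` with `J x' = |J x|`
  obtain ⟨x', hx', hJx'⟩ := exists_null_vector_abs ι J hJcoe hc0 hq habs x hx
  -- `(Jx)⁺ = J((x'+x)/2)`, `(Jx)⁻ = J((x'-x)/2)`
  have e1 : (J x)⁺ + (J x)⁻ = |J x| := posPart_add_negPart (J x)
  have e2 : (J x)⁺ - (J x)⁻ = J x := posPart_sub_negPart (J x)
  have hp : J ((1 / 2 : ℝ) • x' + (1 / 2 : ℝ) • x) = (J x)⁺ := by
    rw [map_add, map_smul, map_smul, hJx', ← smul_add, ← e1]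
    generalize (J x)⁺ = P at *
    generalize (J x)⁻ = N at *
    rw [← e2]
    module
  have hn : J ((1 / 2 : ℝ) • x' + (-(1 / 2) : ℝ) • x) = (J x)⁻ := by
    rw [map_add, map_smul, map_smul, hJx', neg_smul, ← sub_eq_add_neg, ← smul_sub, ← e1]
    generalize (J x)⁺ = P at *
    generalize (J x)⁻ = N at *
    rw [← e2]
    module
  have hp0 := hlin (1 / 2) (1 / 2) x' x hx' hx
  have hn0 := hlin (1 / 2) (-(1 / 2)) x' x hx' hx
  -- POSITIVITY: the two parts cannot both be nonzero
  by_contra hcon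
  have hcon1 : ¬ 0 ≤ J x := fun h => hcon (Or.inl h)
  have hcon2 : ¬ J x ≤ 0 := fun h => hcon (Or.inr h)
  have hpos_ne : (J x)⁺ ≠ 0 := fun h0 => hcon2 (by
    have := posPart_sub_negPart (J x)
    rw [h0, zero_sub] at this
    rw [← this]; exact neg_nonpos.2 (negPart_nonneg _))
  have hneg_ne : (J x)⁻ ≠ 0 := fun h0 => hcon1 (by
    have := posPart_sub_negPart (J x)
    rw [h0, sub_zero] at this
    rw [← this]; exact posPart_nonneg _)
  have hP := hpos (c - 1) (J x)⁺ (by rw [← hp]; exact hJcl _)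
    (by rw [← hp]; exact hGweak _ hp0) (posPart_nonneg _) hpos_ne (J x)⁻ (negPart_nonneg _) hneg_ne
  rw [inner_posPart_negPart_eq_zero] at hP
  exact lt_irrefl _ hP

end Contraction

/-! ### 4. ★ The sign of a ground state reached by a core minimizing sequence -/

section Main

variable {X : Type*} [MeasurableSpace X] {μX : Measure X}
variable {V : Type*} [NormedAddCommGroup V] [InnerProductSpace ℝ V]

/-- ★ **The ground state has a sign — core language, minimizing-sequence form** (Reed–Simon IV Thm XIII.48 /
Courant–Hilbert VI §6 / Lieb–Loss Thm 11.8, variational version).  Data: a real inner product space `V` (the core,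
inner product `(𝔥+1)[·,·]`), `ι : V →L[ℝ] L²(X)`, `S : V → L²(X)` with Kato's identity `⟪f, g⟫_V = ⟪S f, ι g⟫ + ⟪ι f, ι g⟫`;
(contraction) `∀ f ε, ε > 0 → ∃ f', ‖ι f' − |ι f|‖ ≤ ε ∧ ‖f'‖ ≤ ‖f‖ + ε`; (positivity) every nonnegative nonzero
weak solution `w ∈ closure ι(V)` of `⟪w, S g⟫ = c⟪w, ι g⟫ ∀ g` satisfies `⟪w, v⟫ > 0` for all `v ≥ 0`, `v ≠ 0`;
a form lower bound on the core, `m‖ι f‖² ≤ ‖f‖² − ‖ι f‖²` (`= 𝔥[f]`) with `m > −1`.  IF core elements `f_n` have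
`ι f_n → w` in `L²` and `‖f_n‖² − (m+1)‖ι f_n‖² → 0` (i.e. `𝔥[f_n] − m‖ι f_n‖² → 0`: a minimizing sequence for the
level `m`), THEN `0 ≤ w` or `w ≤ 0` in `L²(X)`: a ground state reached along the core does not change sign.
[cite: ReedSimonIV1978, Thm. XIII.48] [cite: LiebLoss2001, Thm. 11.8, PDF pp. 205–206] -/
theorem sign_of_core_minimizing_seq (ι : V →L[ℝ] Lp ℝ 2 μX) (S : V → Lp ℝ 2 μX)
    (hS : ∀ f g : V, ⟪f, g⟫_ℝ = ⟪S f, ι g⟫_ℝ + ⟪ι f, ι g⟫_ℝ)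
    (habs : ∀ (f : V) (ε : ℝ), 0 < ε → ∃ f' : V, ‖ι f' - |ι f|‖ ≤ ε ∧ ‖f'‖ ≤ ‖f‖ + ε)
    (hpos : ∀ (c : ℝ) (w : Lp ℝ 2 μX), w ∈ closure (Set.range ι) →
      (∀ g : V, ⟪w, S g⟫_ℝ = c * ⟪w, ι g⟫_ℝ) → 0 ≤ w → w ≠ 0 →
      ∀ v : Lp ℝ 2 μX, 0 ≤ v → v ≠ 0 → 0 < ⟪w, v⟫_ℝ)
    {m : ℝ} (hm1 : -1 < m) (hm : ∀ f : V, m * ‖ι f‖ ^ 2 ≤ ‖f‖ ^ 2 - ‖ι f‖ ^ 2)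
    (f : ℕ → V) {w : Lp ℝ 2 μX} (hfw : Tendsto (fun n => ι (f n)) atTop (𝓝 w))
    (hmin : Tendsto (fun n => ‖f n‖ ^ 2 - (m + 1) * ‖ι (f n)‖ ^ 2) atTop (𝓝 0)) :
    0 ≤ w ∨ w ≤ 0 := by
  -- `q̃ = ‖·‖² − c‖ι·‖² ≥ 0` on the core, `c = m + 1 > 0`
  set c : ℝ := m + 1 with hc
  have hc0 : 0 < c := by rw [hc]; linarith
  have hqV : ∀ g : V, 0 ≤ ‖g‖ ^ 2 - c * ‖ι g‖ ^ 2 := fun g => by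
    have h := hm g
    rw [hc]; linarith
  -- the completed form domain `Q` and the extension `J` of `ι`
  set L : V →L[ℝ] Completion V := Completion.toComplL with hL
  set J : Completion V →L[ℝ] Lp ℝ 2 μX := ι.extend L with hJ
  have hJcoe : ∀ g : V, J (g : Completion V) = ι g := fun g => extend_toComplL_coe ι g
  -- `q̃ ≥ 0` on `Q` by density
  have hcont : Continuous fun z : Completion V => ‖z‖ ^ 2 - c * ‖J z‖ ^ 2 := by fun_prop
  have hq : ∀ z : Completion V, 0 ≤ ‖z‖ ^ 2 - c * ‖J z‖ ^ 2 := fun z =>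
    Completion.induction_on z (isClosed_le continuous_const hcont)
      fun g => by rw [Completion.norm_coe, hJcoe]; exact hqV g
  -- `(f_n)` is Cauchy in `V`; its limit `x ∈ Q` has `J x = w` and `q̃(x) = 0`
  have hcauchyV : CauchySeq f := cauchySeq_of_qform_tendsto_zero ι hc0 hqV f hmin hfw.cauchySeq
  have hcauchy : CauchySeq fun n => (f n : Completion V) :=
    (Completion.uniformContinuous_coe V).comp_cauchySeq hcauchyV
  obtain ⟨x, hx⟩ := cauchySeq_tendsto_of_complete hcauchy
  have hcoe_seq : (fun n => J (f n : Completion V)) = fun n => ι (f n) := funext fun n => hJcoe (f n)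
  have hJx : J x = w := by
    have h1 : Tendsto (fun n => J (f n : Completion V)) atTop (𝓝 (J x)) := (J.continuous.tendsto x).comp hx
    rw [hcoe_seq] at h1
    exact tendsto_nhds_unique h1 hfw
  have hqx : ‖x‖ ^ 2 - c * ‖J x‖ ^ 2 = 0 := by
    have h1 : Tendsto (fun n => ‖(f n : Completion V)‖ ^ 2 - c * ‖J (f n : Completion V)‖ ^ 2) atTop
        (𝓝 (‖x‖ ^ 2 - c * ‖J x‖ ^ 2)) := (hcont.tendsto x).comp hx
    have hseq : (fun n => ‖(f n : Completion V)‖ ^ 2 - c * ‖J (f n : Completion V)‖ ^ 2) =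
        fun n => ‖f n‖ ^ 2 - c * ‖ι (f n)‖ ^ 2 :=
      funext fun n => by rw [Completion.norm_coe, hJcoe]
    rw [hseq] at h1
    exact tendsto_nhds_unique h1 hmin
  -- the sign of the null vector `x`
  have h := sign_of_null_vector ι S hS J hJcoe habs hpos hc0 hq x hqx
  rwa [hJx] at h

end Main

end Literature.Analysis.UnboundedOperators

end
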